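import Summits.RiemannHypothesis.RiemannHypothesis.Theorems.PfPersistenceF5Comb
import HarnessLib

/-!
# PF persistence, fake seat 5 — the trivial bound: a finite re-weighting moves the form by at most `2‖c‖₁‖g‖₂²`

Unit `pub-rhpf-fake-5` (gen 5) of the `pub-rhpf` cell — mechanism / rigidity campaign; **no RH claims**.
(GAP-CLASSES row F5-SWAP-G, RULING A367 (R5): the 'trivial bound' edge of the undecided sliver, so far
PROVED-informal / one-site only.)

`w' = w_ζ` off a finite set `S`, `c_n := w'(n) − w_ζ(n)`.  For every REAL Weil test `g₁` supported in
`[-b, b]` (`b > 0`):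

* `re_quadratic_eq` — EXACT IDENTITY `Re Q_{w'}(g₁) = Re Q_ζ(g₁) + 2 Σ_{n∈S} (w_ζ(n) − w'(n))·A_{g₁}(log n)`
  (the `m = 1` comb of `PfPersistenceF5Comb.comb_re_eq`);
* `abs_re_quadratic_sub_le` — **TRIVIAL BOUND** `|Re Q_{w'}(g₁) − Re Q_ζ(g₁)| ≤ 2‖c‖₁·‖g₁‖₂²`
  (`|A_{g₁}| ≤ ‖g₁‖₂²`);
* `re_quadratic_nonneg_of_le` — **LOWER EDGE OF THE SLIVER**: if `2‖c‖₁‖g₁‖₂² ≤ Re Q_ζ(g₁)` then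
  `Re Q_{w'}(g₁) ≥ 0` — a real test of half-width `b` whose `ζ`-Rayleigh quotient exceeds twice the `ℓ¹`
  mass of the perturbation is never a negative witness (multi-site version of the one-site hairline
  lemma of cand-7's `PfPersistenceCoefficientRigidity`); together with THEOREM F5-COMB (upper edge:
  a stray-free comb IS a witness once `(2^m − 1)·Re Q_ζ(g₁)/‖g₁‖₂² < Σ c_n ν(log n) ≤ ‖c‖₁·#pairs`) this
  brackets the detection depth of the family between constant multiples of `ζ`'s attainable Rayleigh
  quotient at profile width `b` — the 'onset hairline' of row F5-G, read with `ℓ¹` bookkeeping.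

RH-free, weight-free; no positivity hypothesis anywhere in this file.  References: A. Weil 1952;
E. Bombieri, Rend. Mat. Acc. Lincei (9) 11 (2000) §3–4.
-/

set_option linter.dupNamespace false  -- the mandated namespace repeats `RiemannHypothesis`

noncomputable section

open scoped ArithmeticFunction ComplexConjugate
open Set MeasureTheory Complex Literature.NumberTheory.LFunctions
open Summit.RiemannHypothesis.RiemannHypothesis.Theorems.PfPersistenceDownCone
open Summit.RiemannHypothesis.RiemannHypothesis.Theorems.PfPersistenceBarrier
open Summit.RiemannHypothesis.RiemannHypothesis.Theorems.PfPersistenceBarrier.ExplicitDatum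
open Summit.RiemannHypothesis.RiemannHypothesis.Theorems.PfPersistenceF5SignedTwins (autocorrRe
  abs_autocorrRe_le)
open Summit.RiemannHypothesis.RiemannHypothesis.Theorems.PfPersistenceF5CombPSD (comb)
open Summit.RiemannHypothesis.RiemannHypothesis.Theorems.PfPersistenceF5Comb (combRe comb_re_eq)

namespace Summit.RiemannHypothesis.RiemannHypothesis.Theorems.PfPersistenceF5Sliver

variable {g₁ : ℝ → ℝ} {b : ℝ}

/-- The one-tooth comb at `0` with sign `1` is the test itself. [folklore] -/
theorem comb_one (g : ℝ → ℂ) : comb 1 (fun _ ↦ 0) (fun _ ↦ 1) g = g := by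
  funext t
  simp [comb]

/-- Real version of `comb_one`. [folklore] -/
theorem combRe_one (g₁ : ℝ → ℝ) : combRe 1 (fun _ ↦ 0) (fun _ ↦ 1) g₁ = g₁ := by
  funext t
  simp [combRe]

/-- **Exact identity for a real test.** `Re Q_{w'}(g₁) = Re Q_ζ(g₁) + 2 Σ_{n∈S} (w_ζ(n) − w'(n))·A_{g₁}(log n)`
for `w' = w_ζ` off `S` and `g₁` real, supported in `[-b, b]`, `b > 0`. [folklore] -/
theorem re_quadratic_eq {w' : ℕ → ℝ} {S : Finset ℕ} (hb : 0 < b)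
    (hoff : ∀ n ∉ S, w' n = zetaTable n) (hg : IsWeilTest fun t ↦ (g₁ t : ℂ))
    (hs : tsupport (fun t ↦ (g₁ t : ℂ)) ⊆ Icc (-b) b) :
    ((tableDatum w').quadratic fun t ↦ (g₁ t : ℂ)).re =
      (weilQuadratic fun t ↦ (g₁ t : ℂ)).re
        + 2 * ∑ n ∈ S, (zetaTable n - w' n) * autocorrRe g₁ (Real.log n) := by
  have h := comb_re_eq (m := 1) hb hoff hg hs (A := 0) (fun _ ↦ 0) (fun _ ↦ 1)
    (fun _ ↦ by simp)
  rwa [comb_one, combRe_one] at h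

/-- **TRIVIAL BOUND.** `|Re Q_{w'}(g₁) − Re Q_ζ(g₁)| ≤ 2 (Σ_{n∈S} |c_n|)·‖g₁‖₂²`. [folklore] -/
theorem abs_re_quadratic_sub_le {w' : ℕ → ℝ} {S : Finset ℕ} (hb : 0 < b)
    (hoff : ∀ n ∉ S, w' n = zetaTable n) (hg : IsWeilTest fun t ↦ (g₁ t : ℂ))
    (hs : tsupport (fun t ↦ (g₁ t : ℂ)) ⊆ Icc (-b) b) :
    |((tableDatum w').quadratic fun t ↦ (g₁ t : ℂ)).re - (weilQuadratic fun t ↦ (g₁ t : ℂ)).re|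
      ≤ 2 * (∑ n ∈ S, |w' n - zetaTable n|) * ∫ t, ‖(g₁ t : ℂ)‖ ^ 2 := by
  have hI := fun n : ℕ ↦ abs_autocorrRe_le hg (Real.log n)
  rw [re_quadratic_eq hb hoff hg hs, add_sub_cancel_left, abs_mul, abs_two, mul_assoc]
  refine mul_le_mul_of_nonneg_left ?_ (by norm_num)
  calc |∑ n ∈ S, (zetaTable n - w' n) * autocorrRe g₁ (Real.log n)|
      ≤ ∑ n ∈ S, |(zetaTable n - w' n) * autocorrRe g₁ (Real.log n)| :=
        Finset.abs_sum_le_sum_abs _ _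
    _ ≤ ∑ n ∈ S, |w' n - zetaTable n| * ∫ t, ‖(g₁ t : ℂ)‖ ^ 2 :=
        Finset.sum_le_sum fun n _ ↦ by
          rw [abs_mul, abs_sub_comm]
          exact mul_le_mul_of_nonneg_left (hI n) (abs_nonneg _)
    _ = (∑ n ∈ S, |w' n - zetaTable n|) * ∫ t, ‖(g₁ t : ℂ)‖ ^ 2 := by rw [Finset.sum_mul]

/-- Lower form of the trivial bound: `Re Q_ζ(g₁) − 2‖c‖₁‖g₁‖₂² ≤ Re Q_{w'}(g₁)`. [folklore] -/
theorem re_quadratic_ge {w' : ℕ → ℝ} {S : Finset ℕ} (hb : 0 < b)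
    (hoff : ∀ n ∉ S, w' n = zetaTable n) (hg : IsWeilTest fun t ↦ (g₁ t : ℂ))
    (hs : tsupport (fun t ↦ (g₁ t : ℂ)) ⊆ Icc (-b) b) :
    (weilQuadratic fun t ↦ (g₁ t : ℂ)).re - 2 * (∑ n ∈ S, |w' n - zetaTable n|) * ∫ t, ‖(g₁ t : ℂ)‖ ^ 2
      ≤ ((tableDatum w').quadratic fun t ↦ (g₁ t : ℂ)).re := by
  have h := abs_re_quadratic_sub_le hb hoff hg hs
  rw [abs_le] at h
  linarith [h.1]

/-- Upper form of the trivial bound: `Re Q_{w'}(g₁) ≤ Re Q_ζ(g₁) + 2‖c‖₁‖g₁‖₂²` — a real test of half-width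
`b` can be a negative witness against `w'` only if `Re Q_ζ(g₁) < 2‖c‖₁‖g₁‖₂²`. [folklore] -/
theorem re_quadratic_le {w' : ℕ → ℝ} {S : Finset ℕ} (hb : 0 < b)
    (hoff : ∀ n ∉ S, w' n = zetaTable n) (hg : IsWeilTest fun t ↦ (g₁ t : ℂ))
    (hs : tsupport (fun t ↦ (g₁ t : ℂ)) ⊆ Icc (-b) b) :
    ((tableDatum w').quadratic fun t ↦ (g₁ t : ℂ)).re
      ≤ (weilQuadratic fun t ↦ (g₁ t : ℂ)).re
        + 2 * (∑ n ∈ S, |w' n - zetaTable n|) * ∫ t, ‖(g₁ t : ℂ)‖ ^ 2 := by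
  have h := abs_re_quadratic_sub_le hb hoff hg hs
  rw [abs_le] at h
  linarith [h.2]

/-- **LOWER EDGE OF THE SLIVER (RULING A367 (R5), multi-site, PROVED).** If
`2‖c‖₁‖g₁‖₂² ≤ Re Q_ζ(g₁)` then `Re Q_{w'}(g₁) ≥ 0`: below half of `ζ`'s Rayleigh quotient at the profile,
the `ℓ¹` mass of a finite re-weighting is invisible to that test.  No positivity hypothesis; RH-free,
weight-free. [cite: Bombieri2000Weil, §4] -/
theorem re_quadratic_nonneg_of_le {w' : ℕ → ℝ} {S : Finset ℕ} (hb : 0 < b)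
    (hoff : ∀ n ∉ S, w' n = zetaTable n) (hg : IsWeilTest fun t ↦ (g₁ t : ℂ))
    (hs : tsupport (fun t ↦ (g₁ t : ℂ)) ⊆ Icc (-b) b)
    (hsmall : 2 * (∑ n ∈ S, |w' n - zetaTable n|) * ∫ t, ‖(g₁ t : ℂ)‖ ^ 2
      ≤ (weilQuadratic fun t ↦ (g₁ t : ℂ)).re) :
    0 ≤ ((tableDatum w').quadratic fun t ↦ (g₁ t : ℂ)).re := by
  have h := re_quadratic_ge hb hoff hg hs
  linarith

/-- Rayleigh form of the lower edge: `Re Q_ζ(g₁) ≥ E‖g₁‖₂²` and `‖c‖₁ ≤ E/2` give `Re Q_{w'}(g₁) ≥ 0`.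
[folklore] -/
theorem re_quadratic_nonneg_of_rayleigh {w' : ℕ → ℝ} {S : Finset ℕ} (hb : 0 < b)
    (hoff : ∀ n ∉ S, w' n = zetaTable n) (hg : IsWeilTest fun t ↦ (g₁ t : ℂ))
    (hs : tsupport (fun t ↦ (g₁ t : ℂ)) ⊆ Icc (-b) b) {E : ℝ}
    (hE : E * ∫ t, ‖(g₁ t : ℂ)‖ ^ 2 ≤ (weilQuadratic fun t ↦ (g₁ t : ℂ)).re)
    (hc : 2 * ∑ n ∈ S, |w' n - zetaTable n| ≤ E) :
    0 ≤ ((tableDatum w').quadratic fun t ↦ (g₁ t : ℂ)).re := by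
  refine re_quadratic_nonneg_of_le hb hoff hg hs (le_trans ?_ hE)
  have hpos : 0 ≤ ∫ t, ‖(g₁ t : ℂ)‖ ^ 2 := integral_nonneg fun t ↦ by positivity
  nlinarith

end Summit.RiemannHypothesis.RiemannHypothesis.Theorems.PfPersistenceF5Sliver

end
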